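import Literature.Computability.MetaComplexity.BoundedArithPow2
import Literature.Computability.MetaComplexity.BoundedArithComposition
import HarnessLib

/-!
# Sequence coding, canonical witness sequences and bounded iteration in models of `T₂¹`

Trunk: CplxMeta (G14), topic `Literature/Computability/MetaComplexity`.  This module collects the
bootstrapping layer (Buss 1986, §2.5; Buss 1990, Thm. 8) used by the query presentations: fixed-
width sequence coding (`seqEl`, `seqSet`, …), the sequential greatest-witness principle (canonical
answer codes), and bounded iteration of `Σᵇ`-definable functions.  It is organised in parts
(originally developed as separate files), each introduced by its own module docstring below:
`BoundedArithSeq`, `BoundedArithWitness`, `BoundedArithIterate`.  All parts serve the proof of the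
named fact `Literature.Computability.Complexity.S2_succ_isConservativeOver_T2` (Buss 1990, Thm. 5) by the Herbrand-saturation
route (`Literature/Computability/Complexity/BoundedArithmeticHerbrand.lean`).
-/

/- ===== Part: BoundedArithSeq ===== -/

/-!
# Fixed-width sequence coding in models of `T₂¹`

Trunk: CplxMeta (G14), topic `Literature/Computability/MetaComplexity`.  Third layer of the
bootstrapping inside a model `M ⊨ BASIC + Σᵇ₁-IND` (Buss 1986, §2.5; Krajíček 1995, §5.4):
numbers below `2^{L·b}` are read as sequences of `L` digits of width `b` bits (base `2ᵇ`),
all exponents being taken below a length bound `|S|` (`2ᵏ = pow2B S k`).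

* `digit S b w m = ⌊w / 2ᵐ⌋ mod 2ᵇ` — the width-`b` digit of `w` at bit offset `m`, and the
  decomposition `w = ⌊w/2^{m+b}⌋·2^{m+b} + digit·2ᵐ + (w mod 2ᵐ)`;
* positions: `seqEl S b w p` (digit at offset `p·b`), `seqPre S b w p = ⌊w / 2^{(p+1)b}⌋` (the
  more significant digits), `seqSet S b w p d` (keep the digits above position `p`, put `d` at
  `p`, clear the digits below), with the exchange lemmas `seqPre_seqSet`, `seqEl_seqSet`,
  `seqEl_seqSet_of_lt`, `lt_seqSet` used in maximal-code arguments (Buss 1990, Thm. 8);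
* `Σᵇ₁`-definability of all these functions.

## References

* S. R. Buss, *Bounded Arithmetic*, Bibliopolis 1986, §2.5 (sequence coding in `S₂¹`).
* S. R. Buss, *Axiomatizations and conservation results for fragments of bounded arithmetic*,
  Contemp. Math. 106 (1990), Thm. 8.
* J. Krajíček, *Bounded Arithmetic, Propositional Logic and Complexity Theory*, CUP 1995, §5.4.
-/

namespace Literature.Computability.MetaComplexity

open FirstOrder FirstOrder.Language


namespace BASICModel

variable {M : Type} [Language.boundedArith.Structure M] [hB : M ⊨ BASIC]
  [hI : M ⊨ INDScheme (sigmabFormulas 1)]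

/-! ## Digits of fixed width -/

section Digits

/-- `digit S b w m = ⌊w / 2ᵐ⌋ mod 2ᵇ`: the width-`b` digit of `w` at bit offset `m` (exponents
below `|S|`) (Buss 1986, §2.5, the function `β`; Krajíček 1995, §5.4). [cite: Buss1986, §2.5] -/
noncomputable def digit (S b w m : M) : M := w / pow2B S m % pow2B S b

/-- A digit is `< 2ᵇ`. [cite: Buss1986, §2.5] -/
theorem digit_lt (S b w m : M) : digit S b w m < pow2B S b := mod_lt' _ (pow2B_pos S b)

/-- `digit S b w m` depends on `w` only through `⌊w / 2ᵐ⌋`. [folklore] -/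
theorem digit_congr {S b w w' m : M} (h : w / pow2B S m = w' / pow2B S m) :
    digit S b w m = digit S b w' m := by rw [digit, digit, h]

/-- Shifting by `m + k` is shifting by `m`, then by `k` (`m + k ≤ |S|`). [folklore] -/
theorem div_pow2B_add {S m k : M} (h : m + k ≤ mLen S) (w : M) :
    w / pow2B S (m + k) = w / pow2B S m / pow2B S k := by
  rw [pow2B_add h, div_div']

/-- `⌊w/2ᵐ⌋ = ⌊w/2^{m+b}⌋·2ᵇ + digit S b w m` (`m + b ≤ |S|`). [cite: Buss1986, §2.5] -/
theorem div_pow2B_eq_digit {S b m : M} (h : m + b ≤ mLen S) (w : M) :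
    w / pow2B S m = w / pow2B S (m + b) * pow2B S b + digit S b w m := by
  rw [div_pow2B_add h, digit, div_add_mod']

/-- **Decomposition at a digit**: `w = ⌊w/2^{m+b}⌋·2^{m+b} + (digit S b w m)·2ᵐ + (w mod 2ᵐ)`.
[cite: Buss1986, §2.5] -/
theorem eq_digit_decomp {S b m : M} (h : m + b ≤ mLen S) (w : M) :
    w = w / pow2B S (m + b) * pow2B S (m + b) + digit S b w m * pow2B S m + w % pow2B S m := by
  conv_lhs => rw [← div_add_mod' w (pow2B S m), div_pow2B_eq_digit h w]
  rw [pow2B_add h]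
  ring

/-- Shifts at larger offsets are determined by shifts at smaller ones. [folklore] -/
theorem div_pow2B_congr_of_le {S m m' w w' : M} (hm : m ≤ m') (hm' : m' ≤ mLen S)
    (h : w / pow2B S m = w' / pow2B S m) : w / pow2B S m' = w' / pow2B S m' := by
  obtain ⟨k, rfl⟩ := exists_add_of_le' hm
  rw [div_pow2B_add hm', div_pow2B_add hm', h]

/-- `⌊(x + a·2ᵐ) / 2ᵐ⌋ = a` for `x < 2ᵐ`. [folklore] -/
theorem div_add_mul_pow2B {S m x : M} (hx : x < pow2B S m) (a : M) :
    (x + a * pow2B S m) / pow2B S m = a := by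
  rw [add_mul_div' x a (pow2B_pos S m), (div_eq_zero_iff' (pow2B_pos S m)).2 hx, zero_add]

/-- `(x + a·2ᵐ) mod 2ᵐ = x` for `x < 2ᵐ`. [folklore] -/
theorem mod_add_mul_pow2B {S m x : M} (hx : x < pow2B S m) (a : M) :
    (x + a * pow2B S m) % pow2B S m = x := by
  rw [add_mul_mod', mod_eq_self_of_lt hx]

/-- `x + a·2ᵐ < 2^{m+b}` for `x < 2ᵐ`, `a < 2ᵇ` (`m + b ≤ |S|`). [cite: Buss1986, §2.5] -/
theorem add_mul_pow2B_lt {S m b x a : M} (hx : x < pow2B S m) (ha : a < pow2B S b)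
    (h : m + b ≤ mLen S) : x + a * pow2B S m < pow2B S (m + b) := by
  calc x + a * pow2B S m < pow2B S m + a * pow2B S m := by gcongr
    _ = (a + 1) * pow2B S m := by ring
    _ ≤ pow2B S b * pow2B S m := mul_le_mul'' ((add_one_le_iff' _ _).2 ha) le_rfl
    _ = pow2B S (m + b) := by rw [pow2B_add h, mul_comm]

/-- The digit at offset `m` of `x + a·2ᵐ` is `a mod 2ᵇ` (`x < 2ᵐ`). [cite: Buss1986, §2.5] -/
theorem digit_add_mul_pow2B {S b m x : M} (hx : x < pow2B S m) (a : M) :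
    digit S b (x + a * pow2B S m) m = a % pow2B S b := by
  rw [digit, div_add_mul_pow2B hx]

/-- Digits at offsets `≥ m'` vanish if `w < 2^{m'}` (`m' ≤ m ≤ |S|`). [folklore] -/
theorem digit_eq_zero_of_lt {S b m m' w : M} (hw : w < pow2B S m') (hm : m' ≤ m)
    (hmS : m ≤ mLen S) : digit S b w m = 0 := by
  have h0 : w / pow2B S m = 0 := by
    rw [div_pow2B_congr_of_le hm hmS ((div_eq_zero_iff' (pow2B_pos S m')).2 hw |>.trans
      (zero_div' _).symm), zero_div']
  rw [digit, h0, zero_mod']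

/-- `⌊w / 2ᵐ⌋ < 2ᵏ` if `w < 2^{m+k}` (`m + k ≤ |S|`). [folklore] -/
theorem div_pow2B_lt {S m k w : M} (hw : w < pow2B S (m + k)) (h : m + k ≤ mLen S) :
    w / pow2B S m < pow2B S k := by
  by_contra hle
  push Not at hle
  have : pow2B S (m + k) ≤ w :=
    calc pow2B S (m + k) = pow2B S k * pow2B S m := by rw [pow2B_add h, mul_comm]
      _ ≤ w / pow2B S m * pow2B S m := mul_le_mul'' hle le_rfl
      _ ≤ w := div_mul_le' _ _
  exact hw.not_ge this

end Digits

/-! ## Positions: elements, prefixes, and the exchange operation -/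

section Positions

/-- `seqEl S b w p`: the element at position `p` of the sequence coded by `w` in base `2ᵇ`
(the digit at offset `p·b`; more significant = larger `p`) (Buss 1986, §2.5 `β`).
[cite: Buss1986, §2.5] -/
noncomputable def seqEl (S b w p : M) : M := digit S b w (p * b)

/-- `seqPre S b w p = ⌊w / 2^{(p+1)b}⌋`: the code of the elements at positions `> p`.
[cite: Buss1986, §2.5] -/
noncomputable def seqPre (S b w p : M) : M := w / pow2B S ((p + 1) * b)

/-- `seqSet S b w p d`: keep the elements at positions `> p`, put `d` at position `p`, and clear
the positions `< p` (the exchange operation of maximal-code arguments, Buss 1990, proof of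
Thm. 8). [cite: BussContempMath1990, Thm. 8] -/
noncomputable def seqSet (S b w p d : M) : M :=
  seqPre S b w p * pow2B S ((p + 1) * b) + d * pow2B S (p * b)

/-- An element is `< 2ᵇ`. [cite: Buss1986, §2.5] -/
theorem seqEl_lt (S b w p : M) : seqEl S b w p < pow2B S b := digit_lt _ _ _ _

omit hB hI in
/-- `(p + 1)·b = p·b + b`. [folklore] -/
private theorem succ_mul_eq [M ⊨ BASIC] [M ⊨ INDScheme (sigmabFormulas 1)] (p b : M) :
    (p + 1) * b = p * b + b := by ring

/-- Decomposition of a code at position `p`: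
`w = seqPre·2^{(p+1)b} + seqEl·2^{pb} + (w mod 2^{pb})` (`(p+1)b ≤ |S|`). [cite: Buss1986, §2.5] -/
theorem eq_seq_decomp {S b p : M} (h : (p + 1) * b ≤ mLen S) (w : M) :
    w = seqPre S b w p * pow2B S ((p + 1) * b) + seqEl S b w p * pow2B S (p * b) +
      w % pow2B S (p * b) := by
  rw [seqPre, seqEl]
  rw [succ_mul_eq] at h ⊢
  exact eq_digit_decomp h w

/-- The prefix is unchanged by the exchange operation (`d < 2ᵇ`). [cite: BussContempMath1990, Thm. 8] -/
theorem seqPre_seqSet {S b p d : M} (h : (p + 1) * b ≤ mLen S) (hd : d < pow2B S b) (w : M) :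
    seqPre S b (seqSet S b w p d) p = seqPre S b w p := by
  rw [seqPre, seqSet, add_comm, div_add_mul_pow2B]
  rw [succ_mul_eq] at h ⊢
  calc d * pow2B S (p * b) < pow2B S b * pow2B S (p * b) :=
        (mul_lt_mul_iff_of_pos_right (pow2B_pos S _)).2 hd
    _ = pow2B S (p * b + b) := by rw [pow2B_add h, mul_comm]

/-- The exchange operation puts `d` at position `p` (`d < 2ᵇ`). [cite: BussContempMath1990, Thm. 8] -/
theorem seqEl_seqSet {S b p d : M} (h : (p + 1) * b ≤ mLen S) (hd : d < pow2B S b) (w : M) :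
    seqEl S b (seqSet S b w p d) p = d := by
  rw [seqEl, seqSet, digit, succ_mul_eq, pow2B_add (by rwa [succ_mul_eq] at h)]
  have : seqPre S b w p * (pow2B S (p * b) * pow2B S b) + d * pow2B S (p * b) =
      (d + seqPre S b w p * pow2B S b) * pow2B S (p * b) := by ring
  rw [this, mul_div_cancel_right'' _ (pow2B_pos S _), add_mul_mod', mod_eq_self_of_lt hd]

/-- Shifts of the exchanged code above position `p` agree with those of the original code.
[folklore] -/
theorem div_seqSet_eq {S b p d m : M} (h : (p + 1) * b ≤ m) (hm : m ≤ mLen S) (hd : d < pow2B S b)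
    (w : M) : seqSet S b w p d / pow2B S m = w / pow2B S m :=
  div_pow2B_congr_of_le h hm (seqPre_seqSet (h.trans hm) hd w)

/-- The exchange operation does not change the elements at positions `> p`.
[cite: BussContempMath1990, Thm. 8] -/
theorem seqEl_seqSet_of_lt {S b p q d : M} (hpq : p < q) (hq : (q + 1) * b ≤ mLen S)
    (hd : d < pow2B S b) (w : M) : seqEl S b (seqSet S b w p d) q = seqEl S b w q := by
  have hpq' : (p + 1) * b ≤ q * b := mul_le_mul'' ((add_one_le_iff' p q).2 hpq) le_rfl
  have hqS : q * b ≤ mLen S := le_trans (mul_le_mul'' (le_add_right'' q 1) le_rfl) hq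
  exact digit_congr (div_seqSet_eq hpq' hqS hd w)

/-- The exchange operation does not change the prefixes at positions `≥ p`. [folklore] -/
theorem seqPre_seqSet_of_le {S b p q d : M} (hpq : p ≤ q) (hq : (q + 1) * b ≤ mLen S)
    (hd : d < pow2B S b) (w : M) : seqPre S b (seqSet S b w p d) q = seqPre S b w q :=
  div_seqSet_eq (mul_le_mul'' (by simpa using hpq) le_rfl) hq hd w

/-- The exchange operation clears the positions `< p`: there the elements are `0`
(`(p+1)b ≤ |S|`). [folklore] -/
theorem seqEl_seqSet_of_gt {S b p q d : M} (hqp : q < p) (hp : (p + 1) * b ≤ mLen S) (w : M) :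
    seqEl S b (seqSet S b w p d) q = 0 := by
  -- `seqSet` is a multiple of `2^{(q+1) b}`
  have hqp' : (q + 1) * b ≤ p * b := mul_le_mul'' ((add_one_le_iff' q p).2 hqp) le_rfl
  have hpS : p * b ≤ mLen S := le_trans (mul_le_mul'' (le_add_right'' p 1) le_rfl) hp
  have hqS : q * b + b ≤ mLen S := by
    rw [← succ_mul_eq]
    exact hqp'.trans hpS
  obtain ⟨k, hk⟩ := exists_add_of_le' hqp'
  have hk' : (q + 1) * b + k ≤ mLen S := hk ▸ hpS
  have e1 : pow2B S (p * b) = pow2B S (q * b) * pow2B S b * pow2B S k := by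
    rw [hk, pow2B_add hk', succ_mul_eq, pow2B_add hqS]
  have e2 : pow2B S ((p + 1) * b) = pow2B S (q * b) * pow2B S b * pow2B S k * pow2B S b := by
    rw [succ_mul_eq p b, pow2B_add (by rwa [succ_mul_eq] at hp), e1]
  have e3 : seqSet S b w p d =
      (seqPre S b w p * pow2B S k * pow2B S b + d * pow2B S k) * pow2B S b * pow2B S (q * b) := by
    rw [seqSet, e1, e2]
    ring
  rw [seqEl, digit, e3, mul_div_cancel_right'' _ (pow2B_pos S _), mul_mod_right']

/-- A code `< 2^{Lb}` has prefix `< 2^{(L - p - 1) b}`… stated additively: if `w < 2^{(p+1)b + k}`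
then `seqPre S b w p < 2ᵏ`. [folklore] -/
theorem seqPre_lt {S b p k w : M} (hw : w < pow2B S ((p + 1) * b + k))
    (h : (p + 1) * b + k ≤ mLen S) : seqPre S b w p < pow2B S k :=
  div_pow2B_lt hw h

/-- The exchanged code stays below `2^{(p+1)b + k}` if the original code is. [folklore] -/
theorem seqSet_lt {S b p k d w : M} (hw : w < pow2B S ((p + 1) * b + k))
    (h : (p + 1) * b + k ≤ mLen S) (hd : d < pow2B S b) :
    seqSet S b w p d < pow2B S ((p + 1) * b + k) := by
  have hpre := seqPre_lt hw h
  have hp : (p + 1) * b ≤ mLen S := le_trans (le_add_right'' _ _) h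
  rw [seqSet]
  calc seqPre S b w p * pow2B S ((p + 1) * b) + d * pow2B S (p * b)
      < seqPre S b w p * pow2B S ((p + 1) * b) + pow2B S ((p + 1) * b) := by
        gcongr
        rw [succ_mul_eq, pow2B_add (by rwa [succ_mul_eq] at hp), mul_comm (pow2B S (p * b))]
        exact (mul_lt_mul_iff_of_pos_right (pow2B_pos S _)).2 hd
    _ = (seqPre S b w p + 1) * pow2B S ((p + 1) * b) := by ring
    _ ≤ pow2B S k * pow2B S ((p + 1) * b) :=
        mul_le_mul'' ((add_one_le_iff' _ _).2 hpre) le_rfl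
    _ = pow2B S ((p + 1) * b + k) := by rw [pow2B_add h, mul_comm]

/-- **Comparison**: exchanging for a larger element at position `p` (keeping the more significant
positions) increases the code. [cite: BussContempMath1990, Thm. 8] -/
theorem lt_seqSet {S b p d w : M} (h : (p + 1) * b ≤ mLen S) (hd : seqEl S b w p < d) :
    w < seqSet S b w p d := by
  have hp : p * b ≤ mLen S := le_trans (mul_le_mul'' (le_add_right'' p 1) le_rfl) h
  conv_lhs => rw [eq_seq_decomp h w]
  rw [seqSet]
  calc seqPre S b w p * pow2B S ((p + 1) * b) + seqEl S b w p * pow2B S (p * b) + w % pow2B S (p * b)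
      < seqPre S b w p * pow2B S ((p + 1) * b) + seqEl S b w p * pow2B S (p * b) + pow2B S (p * b) := by
        gcongr
        exact mod_lt' _ (pow2B_pos S _)
    _ = seqPre S b w p * pow2B S ((p + 1) * b) + (seqEl S b w p + 1) * pow2B S (p * b) := by ring
    _ ≤ seqPre S b w p * pow2B S ((p + 1) * b) + d * pow2B S (p * b) := by
        gcongr
        · exact (add_one_le_iff' _ _).2 hd

/-- Elements of a shifted code: `seqEl (⌊w / 2^{mb}⌋) q = seqEl w (q + m)`
(`(q + m + 1)·b ≤ |S|`). [folklore] -/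
theorem seqEl_div_pow2B {S b m q : M} (h : (q + m + 1) * b ≤ mLen S) (w : M) :
    seqEl S b (w / pow2B S (m * b)) q = seqEl S b w (q + m) := by
  have h' : m * b + q * b ≤ mLen S := by
    calc m * b + q * b = (q + m) * b := by ring
      _ ≤ (q + m + 1) * b := mul_le_mul'' (le_add_right'' _ _) le_rfl
      _ ≤ mLen S := h
  rw [seqEl, seqEl, digit, digit, ← div_pow2B_add h']
  congr 2
  ring

/-- Prefixes of a shifted code: `seqPre (⌊w / 2^{mb}⌋) q = seqPre w (q + m)`
(`(q + m + 1)·b ≤ |S|`). [folklore] -/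
theorem seqPre_div_pow2B {S b m q : M} (h : (q + m + 1) * b ≤ mLen S) (w : M) :
    seqPre S b (w / pow2B S (m * b)) q = seqPre S b w (q + m) := by
  have h' : m * b + (q + 1) * b ≤ mLen S := by
    calc m * b + (q + 1) * b = (q + m + 1) * b := by ring
      _ ≤ mLen S := h
  rw [seqPre, seqPre, ← div_pow2B_add h']
  congr 2
  ring

/-- Elements of a truncated code below the truncation point are unchanged:
`seqEl (w mod 2^{mb}) q = seqEl w q` for `q < m` (`m·b ≤ |S|`). [folklore] -/
theorem seqEl_mod_pow2B {S b m q : M} (hq : q < m) (hm : m * b ≤ mLen S) (w : M) :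
    seqEl S b (w % pow2B S (m * b)) q = seqEl S b w q := by
  obtain ⟨k, hk⟩ := exists_add_of_le' ((add_one_le_iff' q m).2 hq)
  have e : m * b = q * b + (b + k * b) := by rw [hk]; ring
  have h1 : q * b + (b + k * b) ≤ mLen S := e ▸ hm
  have h2 : b + k * b ≤ mLen S := le_trans (le_add_left'' _ _) h1
  conv_rhs => rw [seqEl, digit, ← div_add_mod' w (pow2B S (m * b))]
  rw [seqEl, digit, e, pow2B_add h1]
  have : w / (pow2B S (q * b) * pow2B S (b + k * b)) * (pow2B S (q * b) * pow2B S (b + k * b)) +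
      w % (pow2B S (q * b) * pow2B S (b + k * b)) =
      w % (pow2B S (q * b) * pow2B S (b + k * b)) +
        (w / (pow2B S (q * b) * pow2B S (b + k * b)) * pow2B S (b + k * b)) * pow2B S (q * b) := by
    ring
  rw [this, add_mul_div' _ _ (pow2B_pos S _), pow2B_add h2]
  have : w % (pow2B S (q * b) * (pow2B S b * pow2B S (k * b))) / pow2B S (q * b) +
      w / (pow2B S (q * b) * (pow2B S b * pow2B S (k * b))) * (pow2B S b * pow2B S (k * b)) =
      w % (pow2B S (q * b) * (pow2B S b * pow2B S (k * b))) / pow2B S (q * b) +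
        (w / (pow2B S (q * b) * (pow2B S b * pow2B S (k * b))) * pow2B S (k * b)) * pow2B S b := by
    ring
  rw [this, add_mul_mod']

/-- Appending a digit above position `l` does not change the elements at positions `≤ l`:
`seqEl (H + a·2^{(l+1)b}) j = seqEl H j` for `j ≤ l` (`(l+2)·b ≤ |S|`). [cite: Buss1986, §2.5] -/
theorem seqEl_add_mul_pow2B_of_le {S b l j : M} (hj : j ≤ l) (hl : (l + 2) * b ≤ mLen S)
    (H a : M) : seqEl S b (H + a * pow2B S ((l + 1) * b)) j = seqEl S b H j := by
  obtain ⟨k, hk⟩ := exists_add_of_le' hj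
  have e : (l + 1) * b = j * b + (b + k * b) := by rw [hk]; ring
  have h1 : j * b + (b + k * b) ≤ mLen S := by
    rw [← e]
    refine le_trans (mul_le_mul'' ?_ le_rfl) hl
    have e2 : l + 2 = l + 1 + 1 := by ring
    rw [e2]
    exact le_add_right'' (l + 1) 1
  have h2 : b + k * b ≤ mLen S := le_trans (le_add_left'' _ _) h1
  rw [seqEl, seqEl, digit, digit, e, pow2B_add h1]
  have : H + a * (pow2B S (j * b) * pow2B S (b + k * b)) =
      H + (a * pow2B S (b + k * b)) * pow2B S (j * b) := by ring
  rw [this, add_mul_div' _ _ (pow2B_pos S _), pow2B_add h2]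
  have : H / pow2B S (j * b) + a * (pow2B S b * pow2B S (k * b)) =
      H / pow2B S (j * b) + (a * pow2B S (k * b)) * pow2B S b := by ring
  rw [this, add_mul_mod']

/-- Appending the digit `a < 2ᵇ` above position `l` of a code `H < 2^{(l+1)b}` puts `a` at
position `l + 1` (`(l+2)·b ≤ |S|`). [cite: Buss1986, §2.5] -/
theorem seqEl_add_mul_pow2B_self {S b l H a : M} (hH : H < pow2B S ((l + 1) * b))
    (ha : a < pow2B S b) : seqEl S b (H + a * pow2B S ((l + 1) * b)) (l + 1) = a := by
  rw [seqEl, digit_add_mul_pow2B hH, mod_eq_self_of_lt ha]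

/-- The appended code stays small: `H + a·2^{(l+1)b} < 2^{(l+2)b}` for `H < 2^{(l+1)b}`,
`a < 2ᵇ` (`(l+2)·b ≤ |S|`). [cite: Buss1986, §2.5] -/
theorem add_mul_pow2B_lt_succ {S b l H a : M} (hH : H < pow2B S ((l + 1) * b))
    (ha : a < pow2B S b) (hl : (l + 2) * b ≤ mLen S) :
    H + a * pow2B S ((l + 1) * b) < pow2B S ((l + 2) * b) := by
  have e : (l + 2) * b = (l + 1) * b + b := by ring
  rw [e] at hl ⊢
  exact add_mul_pow2B_lt hH ha hl

/-- A truncated code is below the truncation point: `w mod 2^{mb} < 2^{mb}`. [folklore] -/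
theorem mod_pow2B_lt (S w k : M) : w % pow2B S k < pow2B S k := mod_lt' _ (pow2B_pos S k)

end Positions

/-! ## `Σᵇ₁`-definability of the sequence functions -/

section Definability

omit hI in
/-- A term function is `Σᵇᵢ`-definable in a model of `BASIC` (`≤` is reflexive). [folklore] -/
theorem isSigmabFn_of_isTermFn {m : ℕ} {F : (Fin m → M) → M} (hF : IsTermFn F) (i : ℕ) :
    IsSigmabFn i F := hF.isSigmabFn (fun a => le_refl a) i

omit hI in
/-- `+` is a `Σᵇᵢ`-definable binary function. [folklore] -/
theorem isSigmabFn_add (i : ℕ) : IsSigmabFn i fun w : Fin 2 → M => w 0 + w 1 :=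
  isSigmabFn_of_isTermFn ((IsTermFn.proj 0).add (IsTermFn.proj 1)) i

omit hI in
/-- `·` is a `Σᵇᵢ`-definable binary function. [folklore] -/
theorem isSigmabFn_mul (i : ℕ) : IsSigmabFn i fun w : Fin 2 → M => w 0 * w 1 :=
  isSigmabFn_of_isTermFn ((IsTermFn.proj 0).mul (IsTermFn.proj 1)) i

/-- `(S, b, w, m) ↦ digit S b w m` is a `Σᵇ₁`-definable function (bounded by `w`)
(Buss 1986, §2.5: `β` is `Σᵇ₁`-definable with a `Δᵇ₁` graph). [cite: Buss1986, §2.5] -/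
theorem isSigmabFn_digit : IsSigmabFn 1 fun w : Fin 4 → M => digit (w 0) (w 1) (w 2) (w 3) :=
  isSigmabFn_mod.comp₂FnFn (f := (· % ·))
    (isSigmabFn_div_pow2B.comp₃ (f := fun a b c => b / pow2B a c) (IsTermFn.proj 0)
      (IsTermFn.proj 2) (IsTermFn.proj 3))
    (isSigmabFn_pow2B.comp₂ (IsTermFn.proj 0) (IsTermFn.proj 1))
    ⟨fun w => w 2, IsTermFn.proj 2, fun _ => (mod_le_self' _ _).trans (div_le_self' _ _)⟩

/-- `seqEl` is a `Σᵇ₁`-definable function. [cite: Buss1986, §2.5] -/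
theorem isSigmabFn_seqEl : IsSigmabFn 1 fun w : Fin 4 → M => seqEl (w 0) (w 1) (w 2) (w 3) :=
  ((isSigmabFn_digit.comp ![(0 : Fin 5), 1, 2, 4]).snocTerm
    ((IsTermFn.proj 3).mul (IsTermFn.proj 1))).of_eq fun w => by
      simp [seqEl]

/-- `seqPre` is a `Σᵇ₁`-definable function. [cite: Buss1986, §2.5] -/
theorem isSigmabFn_seqPre : IsSigmabFn 1 fun w : Fin 4 → M => seqPre (w 0) (w 1) (w 2) (w 3) :=
  (isSigmabFn_div_pow2B.comp₃ (f := fun a b c => b / pow2B a c) (IsTermFn.proj 0)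
    (IsTermFn.proj 2) (((IsTermFn.proj 3).add isTermFn_one).mul (IsTermFn.proj 1))).of_eq
    fun w => by simp [seqPre]

/-- `seqSet` is a `Σᵇ₁`-definable function. [cite: Buss1986, §2.5] -/
theorem isSigmabFn_seqSet :
    IsSigmabFn 1 fun w : Fin 5 → M => seqSet (w 0) (w 1) (w 2) (w 3) (w 4) := by
  unfold seqSet
  have hpre : IsSigmabFn 1 fun w : Fin 5 → M => seqPre (w 0) (w 1) (w 2) (w 3) :=
    isSigmabFn_seqPre.comp Fin.castSucc
  have hP1 : IsSigmabFn 1 fun w : Fin 5 → M => pow2B (w 0) ((w 3 + 1) * w 1) :=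
    isSigmabFn_pow2B.comp₂ (IsTermFn.proj 0) (((IsTermFn.proj 3).add isTermFn_one).mul
      (IsTermFn.proj 1))
  have hP2 : IsSigmabFn 1 fun w : Fin 5 → M => w 4 * pow2B (w 0) (w 3 * w 1) :=
    (isSigmabFn_mul 1).comp₂Fn (f := (· * ·)) (IsTermFn.proj 4)
      (isSigmabFn_pow2B.comp₂ (IsTermFn.proj 0) ((IsTermFn.proj 3).mul (IsTermFn.proj 1)))
      ⟨fun w => w 4 * (2 * w 0 + 1), (IsTermFn.proj 4).mul (isTermFn_add_one (isTermFn_two_mul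
        (IsTermFn.proj 0))), fun w => mul_le_mul'' le_rfl (pow2B_le _ _)⟩
  have hA : IsSigmabFn 1 fun w : Fin 5 → M =>
      seqPre (w 0) (w 1) (w 2) (w 3) * pow2B (w 0) ((w 3 + 1) * w 1) :=
    (isSigmabFn_mul 1).comp₂FnFn (f := (· * ·)) hpre hP1
      ⟨fun w => w 2 * (2 * w 0 + 1), (IsTermFn.proj 2).mul (isTermFn_add_one (isTermFn_two_mul
        (IsTermFn.proj 0))), fun w => mul_le_mul'' (div_le_self' _ _) (pow2B_le _ _)⟩
  exact (isSigmabFn_add 1).comp₂FnFn (f := (· + ·)) hA hP2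
    ⟨fun w => w 2 * (2 * w 0 + 1) + w 4 * (2 * w 0 + 1),
      ((IsTermFn.proj 2).mul (isTermFn_add_one (isTermFn_two_mul (IsTermFn.proj 0)))).add
        ((IsTermFn.proj 4).mul (isTermFn_add_one (isTermFn_two_mul (IsTermFn.proj 0)))),
      fun w => add_le_add (mul_le_mul'' (div_le_self' _ _) (pow2B_le _ _))
        (mul_le_mul'' le_rfl (pow2B_le _ _))⟩

end Definability

end BASICModel

end Literature.Computability.MetaComplexity


/- ===== Part: BoundedArithWitness ===== -/

/-!
# The sequential greatest-witness principle in models of `T₂ⁱ` (Buss 1990, Thm. 8, semantically)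

Trunk: CplxMeta (G14), topic `Literature/Computability/MetaComplexity`.  Buss 1990, Thm. 8
("`T₂ⁱ` can define `□ᵖᵢ₊₁`-computations": `T₂ⁱ ⊢ ∃w ∀j ≤ |s| (Bit(j, w) = 1 ↔ U(LSP(w, j), j))`
for `U ∈ Σᵇᵢ`, by `Σᵇᵢ`-MAX) in the following digit form, inside a model
`M ⊨ BASIC + Σᵇ₁-IND + Σᵇᵢ₊₁-IND`:

for a `Σᵇᵢ₊₁`-definable (with parameters) family of "queries" `D(pre, p, z)` — where `pre` is
the code of the answers already fixed at the more significant positions `> p` — there is a code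
`w < 2^{L·b}` whose digit `d_p` at each position `p < L` is the canonical answer: `0` if no
`z ≤ t` satisfies `D(seqPre w p, p, z)`, and `1 +` the greatest such `z` otherwise
(`exists_canonSeq`).  The proof takes the greatest `w < 2^{Lb}` all of whose nonzero digits are
(shifted) witnesses — a `Σᵇᵢ₊₁` condition — and uses the exchange operation `seqSet` of
`BoundedArithSeq` (Buss 1990, proof of Thm. 8).  Such codes are unique (`canonSeq_unique`, by
extensionality of digits `ext_of_seqEl`).

This is the tool by which functions computed with sequential `Σᵇᵢ`-witness queries (Buss's
`Qᵢ`-definable functions, Buss 1990, §3) are introduced in models of `T₂ⁱ`.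

## References

* S. R. Buss, *Axiomatizations and conservation results for fragments of bounded arithmetic*,
  Contemp. Math. 106 (1990), §3, Thm. 8.
* S. R. Buss, *Bounded Arithmetic*, Bibliopolis 1986, §2.5.
-/

namespace Literature.Computability.MetaComplexity

namespace BASICModel

open FirstOrder FirstOrder.Language

variable {M : Type} [Language.boundedArith.Structure M] [hB : M ⊨ BASIC]
  [hI : M ⊨ INDScheme (sigmabFormulas 1)]

/-! ## Extensionality of digits -/

section Ext

/-- The digits of `0` vanish. [folklore] -/
@[simp] theorem seqEl_zero (S b p : M) : seqEl S b 0 p = 0 := by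
  simp [seqEl, digit]

/-- **Digits determined by the more significant ones**: if at every position `< L` the digits of
two codes `< 2^{Lb}` agree as soon as their prefixes agree, then the codes are equal
(`L·b ≤ |S|`); by `Πᵇ₁`-induction on the number of leading digits compared (Buss 1986, §2.5).
[cite: Buss1986, §2.5] -/
theorem eq_of_seqEl_eq_of_seqPre_eq {S b L w w' : M} (hL : L * b ≤ mLen S)
    (hw : w < pow2B S (L * b)) (hw' : w' < pow2B S (L * b))
    (h : ∀ p, p < L → seqPre S b w p = seqPre S b w' p → seqEl S b w p = seqEl S b w' p) :
    w = w' := by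
  have key : ∀ j q, q ≤ L → (q + j = L → w / pow2B S (q * b) = w' / pow2B S (q * b)) := by
    intro j
    refine pib_ind (P := fun j => ∀ q, q ≤ L → (q + j = L →
      w / pow2B S (q * b) = w' / pow2B S (q * b))) ?_ ?_ ?_ j
    · have hF : IsSigmabFn 1 fun v : Fin 2 → M => w / pow2B S (v 1 * b) :=
        isSigmabFn_div_pow2B.comp₃ (f := fun a c k => c / pow2B a k) (IsTermFn.const S)
          (IsTermFn.const w) ((IsTermFn.proj 1).mul (IsTermFn.const b))
      have hG : IsSigmabFn 1 fun v : Fin 2 → M => w' / pow2B S (v 1 * b) :=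
        isSigmabFn_div_pow2B.comp₃ (f := fun a c k => c / pow2B a k) (IsTermFn.const S)
          (IsTermFn.const w') ((IsTermFn.proj 1).mul (IsTermFn.const b))
      refine (IsPibDef.ballLE (i := 0)
        (R := fun v : Fin 2 → M => v 1 + v 0 = L → w / pow2B S (v 1 * b) = w' / pow2B S (v 1 * b))
        (IsPibDef.imp ((isQFDef_eq ((IsTermFn.proj 1).add (IsTermFn.proj 0))
          (IsTermFn.const L)).isSigmabDef 1) (hF.isDeltabDef_eq hG).2) (IsTermFn.const L)).of_iff
        fun v => ?_
      simp
    · intro q _ hq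
      rw [add_zero] at hq
      subst hq
      rw [(div_eq_zero_iff' (pow2B_pos S _)).2 hw, (div_eq_zero_iff' (pow2B_pos S _)).2 hw']
    · intro j ih q _ hq
      have hq' : q + 1 + j = L := by rw [← hq]; ring
      have hqL : q < L := by
        rw [← hq, add_comm j, ← add_assoc]
        exact lt_of_lt_of_le (lt_add_one' q) (le_add_right'' _ _)
      have hle : q + 1 ≤ L := (add_one_le_iff' q L).2 hqL
      have hS : q * b + b ≤ mLen S := by
        calc q * b + b = (q + 1) * b := by ring
          _ ≤ L * b := mul_le_mul'' hle le_rfl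
          _ ≤ mLen S := hL
      have e1 := div_pow2B_eq_digit hS w
      have e2 := div_pow2B_eq_digit hS w'
      have e3 : q * b + b = (q + 1) * b := by ring
      rw [e3] at e1 e2
      have hpre : seqPre S b w q = seqPre S b w' q := ih (q + 1) hle hq'
      have hel := h q hqL hpre
      rw [seqEl, seqEl] at hel
      rw [seqPre, seqPre] at hpre
      rw [e1, e2, hpre, hel]
  simpa using key L 0 bot_le (zero_add L)

/-- **Extensionality of digits**: two codes `< 2^{Lb}` with the same digits at all positions
`< L` are equal (`L·b ≤ |S|`) (Buss 1986, §2.5). [cite: Buss1986, §2.5] -/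
theorem ext_of_seqEl {S b L w w' : M} (hL : L * b ≤ mLen S) (hw : w < pow2B S (L * b))
    (hw' : w' < pow2B S (L * b)) (h : ∀ p, p < L → seqEl S b w p = seqEl S b w' p) : w = w' :=
  eq_of_seqEl_eq_of_seqPre_eq hL hw hw' fun p hp _ => h p hp

end Ext

/-! ## The sequential greatest-witness principle -/

section Canon

variable {i : ℕ}

/-- `IsCanonAt D t S b w p`: the digit of `w` at position `p` is the canonical answer to the
query `D(seqPre w p, p, ·)` below `t`: every witness `z ≤ t` satisfies `z + 1 ≤ d`, and if
`d ≠ 0` then `d ≤ t + 1` and `d - 1` is a witness (so `d = 0` iff there is no witness, and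
otherwise `d = 1 + ` the greatest witness) (Buss 1990, Thm. 8, with greatest witnesses in
place of answer bits). [cite: BussContempMath1990, Thm. 8] -/
def IsCanonAt (D : M → M → M → Prop) (t S b w p : M) : Prop :=
  (∀ z, z ≤ t → D (seqPre S b w p) p z → z + 1 ≤ seqEl S b w p) ∧
    (seqEl S b w p ≠ 0 → seqEl S b w p ≤ t + 1 ∧ D (seqPre S b w p) p (seqEl S b w p - 1))

/-- The auxiliary `Σᵇᵢ₊₁` property maximized in the proof of `exists_canonSeq`: `w < 2^{Lb}` and
every nonzero digit of `w` at a position `< L` is `1 +` a witness. [cite: BussContempMath1990, Thm. 8] -/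
def IsWitSeq (D : M → M → M → Prop) (t S b L w : M) : Prop :=
  w < pow2B S (L * b) ∧ ∀ p, p ≤ mLen S → (p < L → seqEl S b w p ≠ 0 →
    (seqEl S b w p ≤ t + 1 ∧ D (seqPre S b w p) p (seqEl S b w p - 1)))

omit hB hI in
/-- A vector of four term functions. [folklore] -/
theorem isTermFn_vec4 {m : ℕ} {T₀ T₁ T₂ T₃ : (Fin m → M) → M} (h₀ : IsTermFn T₀) (h₁ : IsTermFn T₁)
    (h₂ : IsTermFn T₂) (h₃ : IsTermFn T₃) : ∀ j, IsTermFn (![T₀, T₁, T₂, T₃] j) := by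
  intro j
  fin_cases j
  · exact h₀
  · exact h₁
  · exact h₂
  · exact h₃

/-- `(w, p) ↦ seqEl S b w p` is a `Σᵇᵢ₊₁`-definable function (parameters `S, b`). [folklore] -/
theorem isSigmabFn_seqEl₂ (S b : M) (i : ℕ) :
    IsSigmabFn (i + 1) fun u : Fin 2 → M => seqEl S b (u 0) (u 1) :=
  ((isSigmabFn_seqEl.mono (Nat.le_add_left 1 i)).substAll
    (isTermFn_vec4 (IsTermFn.const S) (IsTermFn.const b) (IsTermFn.proj 0) (IsTermFn.proj 1))).of_eq
    fun _ => rfl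

/-- `(w, p) ↦ seqPre S b w p` is a `Σᵇᵢ₊₁`-definable function (parameters `S, b`). [folklore] -/
theorem isSigmabFn_seqPre₂ (S b : M) (i : ℕ) :
    IsSigmabFn (i + 1) fun u : Fin 2 → M => seqPre S b (u 0) (u 1) :=
  ((isSigmabFn_seqPre.mono (Nat.le_add_left 1 i)).substAll
    (isTermFn_vec4 (IsTermFn.const S) (IsTermFn.const b) (IsTermFn.proj 0) (IsTermFn.proj 1))).of_eq
    fun _ => rfl

/-- The matrix of `IsWitSeq`, as a `Σᵇᵢ₊₁` predicate of `(w, p)`. [cite: BussContempMath1990, Thm. 8] -/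
theorem isSigmabDef_isWitSeq_matrix {D : M → M → M → Prop}
    (hD : IsSigmabDef (i + 1) fun u : Fin 3 → M => D (u 0) (u 1) (u 2)) (t S b L : M) :
    IsSigmabDef (i + 1) fun u : Fin 2 → M => u 1 < L → seqEl S b (u 0) (u 1) ≠ 0 →
      (seqEl S b (u 0) (u 1) ≤ t + 1 ∧
        D (seqPre S b (u 0) (u 1)) (u 1) (seqEl S b (u 0) (u 1) - 1)) := by
  have hEl := isSigmabFn_seqEl₂ S b i
  have hPre := isSigmabFn_seqPre₂ S b i
  -- `(w, p, y) ↦ seqEl S b w p - 1`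
  have hElSub : IsSigmabFn (i + 1) fun u : Fin 3 → M => seqEl S b (u 0) (u 1) - 1 :=
    (isSigmabFn_sub (IsTermFn.proj 0) (IsTermFn.proj 1) (i + 1)).comp₂Fn' (f := (· - ·))
      (hEl.comp Fin.castSucc) isTermFn_one
      ⟨fun u => u 0, IsTermFn.proj 0, fun u => tsub_le_self.trans
        ((mod_le_self' _ _).trans (div_le_self' _ _))⟩
  -- `(w, p, y, z) ↦ D y p z`, then substitute `z`, then `y`
  have h1 : IsSigmabDef (i + 1) fun u : Fin 4 → M => D (u 2) (u 1) (u 3) :=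
    hD.comp ![(2 : Fin 4), 1, 3]
  have h2 : IsSigmabDef (i + 1) fun u : Fin 3 → M =>
      D (u 2) (u 1) (seqEl S b (u 0) (u 1) - 1) :=
    (h1.snocFn hElSub).of_iff fun u => by simp
  have h3 : IsSigmabDef (i + 1) fun u : Fin 2 → M =>
      D (seqPre S b (u 0) (u 1)) (u 1) (seqEl S b (u 0) (u 1) - 1) :=
    (h2.snocFn hPre).of_iff fun u => by simp
  have hle : IsDeltabDef (i + 1) fun u : Fin 2 → M => seqEl S b (u 0) (u 1) ≤ t + 1 :=
    hEl.isDeltabDef_le ((isTermFn_add_one (IsTermFn.const t)).isSigmabFn (fun a => le_refl a) _)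
  have hne : IsDeltabDef (i + 1) fun u : Fin 2 → M => seqEl S b (u 0) (u 1) ≠ 0 :=
    (hEl.isDeltabDef_eq (isTermFn_zero.isSigmabFn (fun a => le_refl a) _)).not
  exact IsSigmabDef.imp ((isQFDef_lt (IsTermFn.proj 1) (IsTermFn.const L)).isPibDef _)
    (IsSigmabDef.imp hne.2 (hle.1.and h3))

/-- `IsWitSeq` is `Σᵇᵢ₊₁` (in `w`, with parameters) when `D` is.
[cite: BussContempMath1990, Thm. 8] -/
theorem isSigmabDef_isWitSeq {D : M → M → M → Prop}
    (hD : IsSigmabDef (i + 1) fun u : Fin 3 → M => D (u 0) (u 1) (u 2)) (t S b L : M) :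
    IsSigmabDef (i + 1) fun v : Fin 1 → M => IsWitSeq D t S b L (v 0) := by
  refine ((((isQFDef_lt (IsTermFn.proj 0) (IsTermFn.const (pow2B S (L * b)))).isSigmabDef _).and
    ((isSigmabDef_isWitSeq_matrix hD t S b L).ballLELen (IsTermFn.const S))).of_iff fun v => ?_)
  simp [IsWitSeq]

/-- `0` (all digits `0`) has the auxiliary property. [folklore] -/
theorem isWitSeq_zero (D : M → M → M → Prop) (t S b L : M) : IsWitSeq D t S b L 0 :=
  ⟨pow2B_pos S _, fun p _ _ h => (h (seqEl_zero S b p)).elim⟩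

/-- If `t + 1 < 2ᵇ` then `b ≠ 0`. [folklore] -/
theorem ne_zero_of_lt_pow2B {S b t : M} (ht : t + 1 < pow2B S b) : b ≠ 0 := by
  rintro rfl
  rw [pow2B_zero] at ht
  exact (not_lt.2 (le_add_left'' 1 t)) ht

/-- **Sequential greatest-witness principle** (Buss 1990, Thm. 8, digit form).  In a model of
`BASIC + Σᵇ₁-IND + Σᵇᵢ₊₁-IND`, for a `Σᵇᵢ₊₁`-definable family of queries `D(pre, p, z)`, a
witness bound `t` with `t + 1 < 2ᵇ` and a length `L` with `L·b ≤ |S|`, there is a code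
`w < 2^{Lb}` all of whose digits at positions `< L` are canonical answers (`IsCanonAt`).
Proof: the greatest `w` with `IsWitSeq` (by `Σᵇᵢ₊₁`-MAX); a non-canonical digit at `p` could be
exchanged (`seqSet`) for a larger one, giving a larger `IsWitSeq` code.
[cite: BussContempMath1990, Thm. 8] -/
theorem exists_canonSeq (hIi : M ⊨ INDScheme (sigmabFormulas (i + 1))) {D : M → M → M → Prop}
    (hD : IsSigmabDef (i + 1) fun u : Fin 3 → M => D (u 0) (u 1) (u 2)) {t S b L : M}
    (ht : t + 1 < pow2B S b) (hL : L * b ≤ mLen S) :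
    ∃ w, w < pow2B S (L * b) ∧ ∀ p, p < L → IsCanonAt D t S b w p := by
  obtain ⟨w, ⟨hw, hA⟩, hmax⟩ := exists_greatest_level hIi (isSigmabDef_isWitSeq hD t S b L)
    (isWitSeq_zero D t S b L) (b := pow2B S (L * b)) (fun x hx => hx.1.le)
  refine ⟨w, hw, fun p hp => ?_⟩
  -- position bookkeeping
  obtain ⟨k, hk⟩ := exists_add_of_le' ((add_one_le_iff' p L).2 hp)
  have hLb : L * b = (p + 1) * b + k * b := by rw [hk]; ring
  have hp1 : (p + 1) * b ≤ mLen S :=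
    le_trans (by rw [hLb]; exact le_add_right'' ((p + 1) * b) (k * b)) hL
  have hb : b ≠ 0 := ne_zero_of_lt_pow2B ht
  have hpS : p ≤ mLen S :=
    calc p ≤ p * b := by
          conv_lhs => rw [← mul_one p]
          exact mul_le_mul'' le_rfl ((one_le_iff_ne_zero' b).2 hb)
      _ ≤ (p + 1) * b := mul_le_mul'' (le_add_right'' p 1) le_rfl
      _ ≤ mLen S := hp1
  -- the exchange argument
  have exch : ∀ z, z ≤ t → D (seqPre S b w p) p z → z + 1 ≤ seqEl S b w p := by
    intro z hz hDz
    by_contra hlt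
    push Not at hlt
    have hz1 : z + 1 < pow2B S b := lt_of_le_of_lt (by simpa using hz) ht
    have hww' : w < seqSet S b w p (z + 1) := lt_seqSet hp1 hlt
    have hA' : IsWitSeq D t S b L (seqSet S b w p (z + 1)) := by
      refine ⟨?_, fun q hqS hq hne => ?_⟩
      · rw [hLb] at hw ⊢
        exact seqSet_lt hw (hLb ▸ hL) hz1
      · rcases lt_trichotomy q p with hqp | rfl | hpq
        · exact (hne (seqEl_seqSet_of_gt hqp hp1 w)).elim
        · rw [seqEl_seqSet hp1 hz1, seqPre_seqSet hp1 hz1, add_tsub_cancel_right]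
          exact ⟨by simpa using hz, hDz⟩
        · obtain ⟨k', hk'⟩ := exists_add_of_le' ((add_one_le_iff' q L).2 hq)
          have hq1 : (q + 1) * b ≤ mLen S :=
            le_trans (by rw [hk', add_mul (q + 1) k' b]; exact le_add_right'' ((q + 1) * b) (k' * b)) hL
          rw [seqEl_seqSet_of_lt hpq hq1 hz1, seqPre_seqSet_of_le hpq.le hq1 hz1]
          rw [seqEl_seqSet_of_lt hpq hq1 hz1] at hne
          exact hA q hqS hq hne
    exact hww'.not_ge (hmax _ hA')
  exact ⟨exch, fun hne => hA p hpS hp hne⟩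

/-- Canonical answers are determined by the prefix: two digits canonical for the same query are
equal. [cite: BussContempMath1990, Thm. 8] -/
theorem IsCanonAt.seqEl_eq {D : M → M → M → Prop} {t S b w w' p : M}
    (h : IsCanonAt D t S b w p) (h' : IsCanonAt D t S b w' p)
    (hpre : seqPre S b w p = seqPre S b w' p) : seqEl S b w p = seqEl S b w' p := by
  have key : ∀ {w w' : M}, IsCanonAt D t S b w p → IsCanonAt D t S b w' p →
      seqPre S b w p = seqPre S b w' p → seqEl S b w p ≤ seqEl S b w' p := by
    intro w w' h h' hpre
    rcases eq_or_ne (seqEl S b w p) 0 with h0 | h0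
    · rw [h0]
      exact bot_le
    · obtain ⟨hle, hD⟩ := h.2 h0
      obtain ⟨d, hd⟩ := exists_eq_add_one_of_ne_zero h0
      rw [hd, add_tsub_cancel_right] at hD
      rw [hd] at hle ⊢
      rw [hpre] at hD
      exact h'.1 d (by simpa using hle) hD
  exact le_antisymm (key h h' hpre) (key h' h hpre.symm)

/-- **Uniqueness of canonical sequences**: two codes `< 2^{Lb}` whose digits at all positions
`< L` are canonical answers are equal. [cite: BussContempMath1990, Thm. 8] -/
theorem canonSeq_unique {D : M → M → M → Prop} {t S b L w w' : M} (hL : L * b ≤ mLen S)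
    (hw : w < pow2B S (L * b)) (hw' : w' < pow2B S (L * b))
    (h : ∀ p, p < L → IsCanonAt D t S b w p) (h' : ∀ p, p < L → IsCanonAt D t S b w' p) :
    w = w' :=
  eq_of_seqEl_eq_of_seqPre_eq hL hw hw' fun p hp hpre => (h p hp).seqEl_eq (h' p hp) hpre

/-! ### Causal form: queries reading the more significant digits of the code itself -/

/-- `IsCanonAtC D t S b w p`: as `IsCanonAt`, for a query `D(w, p, z)` that reads the code `w`
itself (at positions `> p`). [cite: BussContempMath1990, Thm. 8] -/
def IsCanonAtC (D : M → M → M → Prop) (t S b w p : M) : Prop :=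
  (∀ z, z ≤ t → D w p z → z + 1 ≤ seqEl S b w p) ∧
    (seqEl S b w p ≠ 0 → seqEl S b w p ≤ t + 1 ∧ D w p (seqEl S b w p - 1))

/-- `IsCausal D S b`: the query `D(w, p, z)` depends only on the digits of `w` at the positions
`> p` (below `|S|`). [cite: BussContempMath1990, Thm. 8] -/
def IsCausal (D : M → M → M → Prop) (S b : M) : Prop :=
  ∀ w w' p z, (∀ q, p < q → (q + 1) * b ≤ mLen S → seqEl S b w q = seqEl S b w' q) →
    (D w p z ↔ D w' p z)

/-- The prefix code, shifted back into place, has the same digits above `p` as the code: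
`seqEl (seqPre w p · 2^{(p+1)b}) q = seqEl w q` for `p < q` (it is `seqSet w p 0`). [folklore] -/
theorem seqEl_seqPre_mul {S b p q : M} (hpq : p < q) (hq : (q + 1) * b ≤ mLen S) (w : M) :
    seqEl S b (seqPre S b w p * pow2B S ((p + 1) * b)) q = seqEl S b w q := by
  have : seqPre S b w p * pow2B S ((p + 1) * b) = seqSet S b w p 0 := by simp [seqSet]
  rw [this]
  exact seqEl_seqSet_of_lt hpq hq (pow2B_pos S b) w

/-- A causal query, evaluated on the shifted prefix, is the query itself. [folklore] -/
theorem IsCausal.iff_seqPre {D : M → M → M → Prop} {S b : M} (hD : IsCausal D S b) (w p z : M) :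
    D (seqPre S b w p * pow2B S ((p + 1) * b)) p z ↔ D w p z :=
  hD _ _ p z fun _ hpq hq => seqEl_seqPre_mul hpq hq w

/-- Canonical answers to equivalent queries are equal (possibly for different coding parameters).
[cite: BussContempMath1990, Thm. 8] -/
theorem IsCanonAtC.seqEl_eq_of_iff {D D' : M → M → M → Prop} {t S b S' b' w w' p : M}
    (h : IsCanonAtC D t S b w p) (h' : IsCanonAtC D' t S' b' w' p)
    (hiff : ∀ z, D w p z ↔ D' w' p z) : seqEl S b w p = seqEl S' b' w' p := by
  have key : ∀ {D D' : M → M → M → Prop} {S b S' b' w w' : M}, IsCanonAtC D t S b w p →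
      IsCanonAtC D' t S' b' w' p → (∀ z, D w p z ↔ D' w' p z) →
      seqEl S b w p ≤ seqEl S' b' w' p := by
    intro D D' S b S' b' w w' h h' hiff
    rcases eq_or_ne (seqEl S b w p) 0 with h0 | h0
    · rw [h0]
      exact bot_le
    · obtain ⟨hle, hD⟩ := h.2 h0
      obtain ⟨d, hd⟩ := exists_eq_add_one_of_ne_zero h0
      rw [hd, add_tsub_cancel_right] at hD
      rw [hd] at hle ⊢
      exact h'.1 d (by simpa using hle) ((hiff d).1 hD)
  exact le_antisymm (key h h' hiff) (key h' h fun z => (hiff z).symm)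

/-- For a guarded query (`D w p z → z ≤ t`), canonicity does not depend on the witness bound
above `t`. [folklore] -/
theorem IsCanonAtC.of_le {D : M → M → M → Prop} {t t' S b w p : M}
    (hDt : ∀ z, D w p z → z ≤ t) (htt' : t ≤ t') (h : IsCanonAtC D t' S b w p) :
    IsCanonAtC D t S b w p := by
  refine ⟨fun z hz hDz => h.1 z (hz.trans htt') hDz, fun hne => ?_⟩
  obtain ⟨-, hD⟩ := h.2 hne
  refine ⟨?_, hD⟩
  have := hDt _ hD
  obtain ⟨d, hd⟩ := exists_eq_add_one_of_ne_zero hne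
  rw [hd, add_tsub_cancel_right] at this
  rw [hd]
  simpa using this

/-- For a guarded query, canonicity for bound `t` gives canonicity for any larger bound.
[folklore] -/
theorem IsCanonAtC.mono {D : M → M → M → Prop} {t t' S b w p : M}
    (hDt : ∀ z, D w p z → z ≤ t) (htt' : t ≤ t') (h : IsCanonAtC D t S b w p) :
    IsCanonAtC D t' S b w p := by
  refine ⟨fun z _ hDz => h.1 z (hDt z hDz) hDz, fun hne => ?_⟩
  obtain ⟨hle, hD⟩ := h.2 hne
  exact ⟨hle.trans (by simpa using htt'), hD⟩

/-- Canonicity at a position depends only on the digit there and on the query there. [folklore] -/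
theorem IsCanonAtC.transfer {D D' : M → M → M → Prop} {t S b S' b' w w' p p' : M}
    (h : IsCanonAtC D t S b w p) (hiff : ∀ z, D w p z ↔ D' w' p' z)
    (hel : seqEl S b w p = seqEl S' b' w' p') : IsCanonAtC D' t S' b' w' p' := by
  obtain ⟨h1, h2⟩ := h
  rw [hel] at h1 h2
  exact ⟨fun z hz hDz => h1 z hz ((hiff z).2 hDz), fun hne => ⟨(h2 hne).1, (hiff _).1 (h2 hne).2⟩⟩

/-- **Sequential greatest-witness principle, causal form**: for a `Σᵇᵢ₊₁`-definable causal
query `D(w, p, z)` there is a code `w < 2^{Lb}` all of whose digits are canonical answers to the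
queries about `w` itself. [cite: BussContempMath1990, Thm. 8] -/
theorem exists_canonSeqC (hIi : M ⊨ INDScheme (sigmabFormulas (i + 1))) {D : M → M → M → Prop}
    (hD : IsSigmabDef (i + 1) fun u : Fin 3 → M => D (u 0) (u 1) (u 2)) {t S b L : M}
    (hDc : IsCausal D S b) (ht : t + 1 < pow2B S b) (hL : L * b ≤ mLen S) :
    ∃ w, w < pow2B S (L * b) ∧ ∀ p, p < L → IsCanonAtC D t S b w p := by
  -- the prefix form of the query
  have hD' : IsSigmabDef (i + 1) fun u : Fin 3 → M =>
      D (u 0 * pow2B S ((u 1 + 1) * b)) (u 1) (u 2) := by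
    have h1 : IsSigmabDef (i + 1) fun u : Fin 4 → M => D (u 3) (u 1) (u 2) :=
      hD.comp ![(3 : Fin 4), 1, 2]
    have hF : IsSigmabFn (i + 1) fun u : Fin 3 → M => u 0 * pow2B S ((u 1 + 1) * b) :=
      (isSigmabFn_mul (i + 1)).comp₂Fn (f := (· * ·)) (IsTermFn.proj 0)
        ((isSigmabFn_pow2B' i).comp₂ (IsTermFn.const S) ((isTermFn_add_one (IsTermFn.proj 1)).mul
          (IsTermFn.const b)))
        ⟨fun u => u 0 * (2 * S + 1), (IsTermFn.proj 0).mul (isTermFn_add_one (isTermFn_two_mul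
          (IsTermFn.const S))), fun u => mul_le_mul'' le_rfl (pow2B_le _ _)⟩
    exact (h1.snocFn hF).of_iff fun u => by simp
  obtain ⟨w, hw, hc⟩ := exists_canonSeq hIi (D := fun pre p z => D (pre * pow2B S ((p + 1) * b)) p z)
    hD' ht hL
  refine ⟨w, hw, fun p hp => ?_⟩
  obtain ⟨h1, h2⟩ := hc p hp
  refine ⟨fun z hz hDz => h1 z hz ((hDc.iff_seqPre w p z).2 hDz), fun hne => ?_⟩
  obtain ⟨h3, h4⟩ := h2 hne
  exact ⟨h3, (hDc.iff_seqPre w p _).1 h4⟩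

/-- Uniqueness of canonical sequences, causal form. [cite: BussContempMath1990, Thm. 8] -/
theorem canonSeqC_unique {D : M → M → M → Prop} {t S b L w w' : M} (hDc : IsCausal D S b)
    (hL : L * b ≤ mLen S) (hw : w < pow2B S (L * b)) (hw' : w' < pow2B S (L * b))
    (h : ∀ p, p < L → IsCanonAtC D t S b w p) (h' : ∀ p, p < L → IsCanonAtC D t S b w' p) :
    w = w' := by
  refine eq_of_seqEl_eq_of_seqPre_eq hL hw hw' fun p hp hpre => ?_
  -- the queries at `p` about `w` and `w'` agree, since the digits above `p` agree
  have hiff : ∀ z, D w p z ↔ D w' p z := fun z => by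
    rw [← hDc.iff_seqPre w p z, ← hDc.iff_seqPre w' p z, hpre]
  have hc : IsCanonAt (fun pre q z => D (pre * pow2B S ((q + 1) * b)) q z) t S b w p :=
    ⟨fun z hz hDz => (h p hp).1 z hz ((hDc.iff_seqPre w p z).1 hDz),
      fun hne => ⟨((h p hp).2 hne).1, (hDc.iff_seqPre w p _).2 ((h p hp).2 hne).2⟩⟩
  have hc' : IsCanonAt (fun pre q z => D (pre * pow2B S ((q + 1) * b)) q z) t S b w' p :=
    ⟨fun z hz hDz => (h' p hp).1 z hz ((hDc.iff_seqPre w' p z).1 hDz),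
      fun hne => ⟨((h' p hp).2 hne).1, (hDc.iff_seqPre w' p _).2 ((h' p hp).2 hne).2⟩⟩
  exact hc.seqEl_eq hc' hpre

end Canon

end BASICModel

end Literature.Computability.MetaComplexity


/- ===== Part: BoundedArithIterate ===== -/

/-!
# Bounded iteration of `Σᵇ`-definable functions in models of `T₂ⁱ⁺¹`

Trunk: CplxMeta (G14), topic `Literature/Computability/MetaComplexity`.  In a model
`M ⊨ BASIC + Σᵇ₁-IND + Σᵇᵢ₊₁-IND`, a `Σᵇᵢ₊₁`-definable step function `F(x̄, l, y)` whose values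
are bounded by a term `r(x̄)` can be iterated a small (length-sized, `≤ |s(x̄)|`) number of times:
there is a `Σᵇᵢ₊₁`-definable function `iter(x̄, l) = F(x̄, l-1, F(x̄, l-2, … F(x̄, 0, init x̄)…))`
satisfying the recursion equations `iter_zero`, `iter_succ` (Buss 1986, §2.6 "limited iteration";
Buss 1990, Thm. 11).  The computation is the sequence of intermediate values, coded in base
`2^{|r(x̄)|}` (`BoundedArithSeq`); its existence is proved by `Σᵇᵢ₊₁`-induction on the number of
steps (`exists_isItSeq`) and its digits are unique (`IsItSeq.seqEl_eq`).

## References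

* S. R. Buss, *Bounded Arithmetic*, Bibliopolis 1986, §2.6 (closure of `Σᵇ₁`-definable
  functions of `S₂¹` under limited iteration).
* S. R. Buss, *Axiomatizations and conservation results for fragments of bounded arithmetic*,
  Contemp. Math. 106 (1990), Thm. 11.
-/

namespace Literature.Computability.MetaComplexity

namespace BASICModel

open FirstOrder FirstOrder.Language

variable {M : Type} [Language.boundedArith.Structure M] [hB : M ⊨ BASIC]
  [hI : M ⊨ INDScheme (sigmabFormulas 1)] {i m : ℕ}

section Iterate

variable (F : (Fin (m + 2) → M) → M) (init r sN : (Fin m → M) → M)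

/-- The digit width used to code the computation: `|r(x̄)|` (all values are `≤ r(x̄) < 2^{|r|}`).
[folklore] -/
def itWidth (xs : Fin m → M) : M := mLen (r xs)

/-- The length bound under which all exponents are taken: `(2·s + 1) # (2·r + 1)`, of length
`(|s| + 1)(|r| + 1) + 1`. [folklore] -/
def itBound (xs : Fin m → M) : M := mSmash (2 * sN xs + 1) (2 * r xs + 1)

/-- `IsItSeq F init r s x̄ l H`: `H` codes the computation `y₀ = init x̄, y_{j+1} = F(x̄, j, y_j)`
for `j < l`, as `l + 1` digits of width `|r x̄|` (Buss 1986, §2.6). [cite: Buss1986, §2.6] -/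
def IsItSeq (xs : Fin m → M) (l H : M) : Prop :=
  H < pow2B (itBound r sN xs) ((l + 1) * itWidth r xs) ∧
    (seqEl (itBound r sN xs) (itWidth r xs) H 0 = init xs ∧
      ∀ j, j ≤ mLen (itBound r sN xs) → (j < l →
        seqEl (itBound r sN xs) (itWidth r xs) H (j + 1) =
          F (Fin.snoc (Fin.snoc xs j) (seqEl (itBound r sN xs) (itWidth r xs) H j))))

open scoped Classical in
/-- `iter F init r s x̄ l`: the `l`-th iterate `y_l` (`y₀ = init x̄`, `y_{j+1} = F(x̄, j, y_j)`) for
`l ≤ |s x̄|`, read off any computation `H` (they all have the same digits); `0` for `l > |s x̄|`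
(Buss 1986, §2.6). [cite: Buss1986, §2.6] -/
noncomputable def iter (xs : Fin m → M) (l : M) : M :=
  if h : l ≤ mLen (sN xs) ∧ ∃ H, IsItSeq F init r sN xs l H then
    seqEl (itBound r sN xs) (itWidth r xs) (Classical.choose h.2) l
  else 0

variable {F init r sN}

omit hI in
/-- `|itBound| = (|s| + 1)·(|r| + 1) + 1`. [folklore] -/
theorem mLen_itBound (xs : Fin m → M) :
    mLen (itBound r sN xs) = (mLen (sN xs) + 1) * (mLen (r xs) + 1) + 1 := by
  rw [itBound, mLen_mSmash, mLen_two_mul_add_one, mLen_two_mul_add_one]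

omit hI in
/-- The exponents used fit below `|itBound|`: `L·|r| ≤ |itBound|` for `L ≤ |s| + 1`. [folklore] -/
theorem itExp_le {xs : Fin m → M} {L : M} (hL : L ≤ mLen (sN xs) + 1) :
    L * itWidth r xs ≤ mLen (itBound r sN xs) := by
  rw [mLen_itBound, itWidth]
  calc L * mLen (r xs) ≤ (mLen (sN xs) + 1) * (mLen (r xs) + 1) :=
        mul_le_mul'' hL (le_add_right'' _ _)
    _ ≤ _ := le_add_right'' _ _

/-- `|s| ≤ |itBound|`. [folklore] -/
theorem mLen_sN_le (xs : Fin m → M) : mLen (sN xs) ≤ mLen (itBound r sN xs) := by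
  rw [mLen_itBound]
  calc mLen (sN xs) ≤ mLen (sN xs) + 1 := le_add_right'' _ _
    _ ≤ (mLen (sN xs) + 1) * (mLen (r xs) + 1) := by
        conv_lhs => rw [← mul_one (mLen (sN xs) + 1)]
        exact mul_le_mul'' le_rfl (le_add_left'' 1 _)
    _ ≤ _ := le_add_right'' _ _

/-- `|r| ≤ |itBound|`. [folklore] -/
theorem itWidth_le (xs : Fin m → M) : itWidth r xs ≤ mLen (itBound r sN xs) := by
  simpa using itExp_le (r := r) (sN := sN) (xs := xs) (L := 1) (le_add_left'' 1 _)

/-- Values `≤ r(x̄)` are digits: `y ≤ r x̄ → y < 2^{|r x̄|}`. [folklore] -/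
theorem lt_pow2B_itWidth {xs : Fin m → M} {y : M} (hy : y ≤ r xs) :
    y < pow2B (itBound r sN xs) (itWidth r xs) := by
  have h : mLen (r xs) ≤ mLen (itBound r sN xs) := itWidth_le (r := r) (sN := sN) xs
  unfold itWidth
  rw [pow2B_congr h le_rfl]
  exact lt_pow2B_mLen_of_mLen_le (mLen_le_mLen hy)

omit hI in
/-- `0 < l + 1`. [folklore] -/
theorem zero_lt_add_one' (l : M) : 0 < l + 1 := lt_of_lt_of_le zero_lt_one (le_add_left'' 1 l)

/-! ### Uniqueness of digits, truncation -/

/-- Truncating a computation of length `l + 2` gives one of length `l + 1`. [folklore] -/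
theorem IsItSeq.restrict {xs : Fin m → M} {l H : M} (hl : l + 1 ≤ mLen (sN xs))
    (h : IsItSeq F init r sN xs (l + 1) H) :
    IsItSeq F init r sN xs l (H % pow2B (itBound r sN xs) ((l + 1) * itWidth r xs)) := by
  have hle : (l + 1) * itWidth r xs ≤ mLen (itBound r sN xs) :=
    itExp_le (hl.trans (le_add_right'' _ _))
  refine ⟨mod_pow2B_lt _ _ _, ?_, fun j hj hjl => ?_⟩
  · rw [seqEl_mod_pow2B (zero_lt_add_one' l) hle, h.2.1]
  · have hj1 : j + 1 < l + 1 := by simpa using hjl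
    rw [seqEl_mod_pow2B hj1 hle, seqEl_mod_pow2B (hjl.trans (lt_add_one' l)) hle]
    exact h.2.2 j hj (hjl.trans (lt_add_one' l))

/-- **The digits of a computation are unique** (by `Σᵇ₁`-induction on the position).
[cite: Buss1986, §2.6] -/
theorem IsItSeq.seqEl_eq {xs : Fin m → M} {l H H' : M} (h : IsItSeq F init r sN xs l H)
    (h' : IsItSeq F init r sN xs l H') (hl : l ≤ mLen (sN xs)) {j : M} (hj : j ≤ l) :
    seqEl (itBound r sN xs) (itWidth r xs) H j = seqEl (itBound r sN xs) (itWidth r xs) H' j := by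
  set S := itBound r sN xs
  set b := itWidth r xs
  revert hj
  refine ind (P := fun j => j ≤ l → seqEl S b H j = seqEl S b H' j) ?_ ?_ ?_ j
  · have hEl := isSigmabFn_seqEl₂ S b 0
    exact IsSigmabDef.imp ((isQFDef_le (IsTermFn.proj 0) (IsTermFn.const l)).isPibDef 1)
      ((hEl.comp₂ (f := fun a c => seqEl S b a c) (IsTermFn.const H) (IsTermFn.proj 0)).isDeltabDef_eq
        (hEl.comp₂ (f := fun a c => seqEl S b a c) (IsTermFn.const H') (IsTermFn.proj 0))).1
  · intro _
    rw [h.2.1, h'.2.1]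
  · intro j ih hj
    have hjl : j < l := (add_one_le_iff' j l).1 hj
    have hjS : j ≤ mLen S := (hjl.le.trans hl).trans (mLen_sN_le xs)
    rw [h.2.2 j hjS hjl, h'.2.2 j hjS hjl, ih hjl.le]

variable (hFr : ∀ u : Fin (m + 2) → M, F u ≤ r (Fin.init (Fin.init u)))
  (hinit : ∀ xs, init xs ≤ r xs)
include hFr hinit

omit hI hinit in
/-- The value bound at an argument written with `Fin.snoc`. [folklore] -/
theorem step_le (xs : Fin m → M) (l c : M) : F (Fin.snoc (Fin.snoc xs l) c) ≤ r xs := by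
  simpa using hFr (Fin.snoc (Fin.snoc xs l) c)

omit hinit in
/-- Appending the next value to a computation. [cite: Buss1986, §2.6] -/
theorem IsItSeq.append {xs : Fin m → M} {l H : M} (hl : l + 1 ≤ mLen (sN xs))
    (h : IsItSeq F init r sN xs l H) :
    IsItSeq F init r sN xs (l + 1)
      (H + F (Fin.snoc (Fin.snoc xs l) (seqEl (itBound r sN xs) (itWidth r xs) H l)) *
        pow2B (itBound r sN xs) ((l + 1) * itWidth r xs)) := by
  set S := itBound r sN xs
  set b := itWidth r xs
  set a := F (Fin.snoc (Fin.snoc xs l) (seqEl S b H l))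
  have ha : a < pow2B S b := lt_pow2B_itWidth (step_le hFr xs l _)
  have hl2 : (l + 2) * b ≤ mLen S := itExp_le (by
    have h2 := (add_le_add_iff_right 1).2 hl
    rwa [add_assoc, one_add_one_eq_two] at h2)
  refine ⟨?_, ?_, fun j hj hjl => ?_⟩
  · have := add_mul_pow2B_lt_succ h.1 ha hl2
    convert this using 2
    ring
  · rw [seqEl_add_mul_pow2B_of_le (zero_le : (0 : M) ≤ l) hl2, h.2.1]
  · rcases ((lt_add_one_iff' j l).1 hjl).eq_or_lt with rfl | hjl'
    · rw [seqEl_add_mul_pow2B_self h.1 ha, seqEl_add_mul_pow2B_of_le le_rfl hl2]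
    · rw [seqEl_add_mul_pow2B_of_le ((add_one_le_iff' _ _).2 hjl') hl2,
        seqEl_add_mul_pow2B_of_le hjl'.le hl2]
      exact h.2.2 j hj hjl'

omit hFr in
/-- The one-digit computation `init x̄` of length `1`. [folklore] -/
theorem isItSeq_zero (xs : Fin m → M) : IsItSeq F init r sN xs 0 (init xs) := by
  have h0 : init xs < pow2B (itBound r sN xs) (itWidth r xs) := lt_pow2B_itWidth (hinit xs)
  refine ⟨by simpa using h0, ?_, fun j _ hj => (not_lt_bot hj).elim⟩
  rw [seqEl, zero_mul, digit, pow2B_zero, div_one', mod_eq_self_of_lt h0]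

/-! ### Definability of `IsItSeq`, uniformly in all arguments -/

omit hFr hinit in
/-- `IsItSeq` is `Σᵇᵢ₊₁`-definable in `(x̄, l, H)` (for `Σᵇᵢ₊₁`-definable `F` and term functions
`init, r, s`). [cite: Buss1986, §2.6] -/
theorem isSigmabDef_isItSeq (hF : IsSigmabFn (i + 1) F) (hinitF : IsSigmabFn (i + 1) init)
    (hr : IsTermFn r) (hsN : IsTermFn sN)
    (hFr : ∀ u : Fin (m + 2) → M, F u ≤ r (Fin.init (Fin.init u))) :
    IsSigmabDef (i + 1) fun u : Fin (m + 2) → M =>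
      IsItSeq F init r sN (Fin.init (Fin.init u)) (u (Fin.last m).castSucc) (u (Fin.last (m + 1))) := by
  -- term functions on the context `(x̄, l, H)` and on `(x̄, l, H, j)`
  have hxs2 : ∀ {T : (Fin m → M) → M}, IsTermFn T →
      IsTermFn fun u : Fin (m + 2) → M => T (Fin.init (Fin.init u)) := fun hT =>
    ((hT.comp Fin.castSucc).comp Fin.castSucc).of_eq fun _ => rfl
  have hxs3 : ∀ {T : (Fin m → M) → M}, IsTermFn T →
      IsTermFn fun v : Fin (m + 3) → M => T (Fin.init (Fin.init (Fin.init v))) := fun hT =>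
    (((hT.comp Fin.castSucc).comp Fin.castSucc).comp Fin.castSucc).of_eq fun _ => rfl
  have hbd2 : IsTermFn fun u : Fin (m + 2) → M => itBound r sN (Fin.init (Fin.init u)) :=
    ((isTermFn_add_one (isTermFn_two_mul (hxs2 hsN))).smash
      (isTermFn_add_one (isTermFn_two_mul (hxs2 hr)))).of_eq fun _ => rfl
  have hbd3 : IsTermFn fun v : Fin (m + 3) → M => itBound r sN (Fin.init (Fin.init (Fin.init v))) :=
    (hbd2.comp Fin.castSucc).of_eq fun _ => rfl
  have hw2 : IsTermFn fun u : Fin (m + 2) → M => itWidth r (Fin.init (Fin.init u)) :=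
    (hxs2 hr).len
  have hw3 : IsTermFn fun v : Fin (m + 3) → M => itWidth r (Fin.init (Fin.init (Fin.init v))) :=
    (hw2.comp Fin.castSucc).of_eq fun _ => rfl
  have hEl := isSigmabFn_seqEl.mono (Nat.le_add_left 1 i) (M := M)
  refine IsSigmabDef.and ?_ (IsSigmabDef.and ?_ ?_)
  · -- `H < pow2B S ((l + 1)·b)`
    have h1 : IsSigmabFn (i + 1) fun u : Fin (m + 2) → M =>
        pow2B (itBound r sN (Fin.init (Fin.init u))) ((u (Fin.last m).castSucc + 1) *
          itWidth r (Fin.init (Fin.init u))) :=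
      (isSigmabFn_pow2B' i).comp₂ hbd2 ((isTermFn_add_one (IsTermFn.proj _)).mul hw2)
    have h2 : IsSigmabFn (i + 1) fun u : Fin (m + 2) → M => u (Fin.last (m + 1)) :=
      (IsTermFn.proj _).isSigmabFn (fun a => le_refl a) _
    refine ((h2.isDeltabDef_le h1).1.and (h1.isDeltabDef_le h2).2.not).of_iff fun u => ?_
    simp only [mLe_iff]
    exact lt_iff_le_not_ge.symm
  · -- `seqEl S b H 0 = init x̄`
    have h1 : IsSigmabFn (i + 1) fun u : Fin (m + 2) → M =>
        seqEl (itBound r sN (Fin.init (Fin.init u))) (itWidth r (Fin.init (Fin.init u)))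
          (u (Fin.last (m + 1))) 0 :=
      (hEl.substAll (isTermFn_vec4 hbd2 hw2 (IsTermFn.proj (Fin.last (m + 1))) isTermFn_zero)).of_eq
        fun u => rfl
    exact (h1.isDeltabDef_eq ((hinitF.comp Fin.castSucc).comp Fin.castSucc |>.of_eq fun _ => rfl)).1
  · -- the recursion clause
    refine IsSigmabDef.ballLELen (i := i) (R := fun v : Fin (m + 3) → M =>
      v (Fin.last (m + 2)) < v (Fin.last m).castSucc.castSucc →
        seqEl (itBound r sN (Fin.init (Fin.init (Fin.init v))))
          (itWidth r (Fin.init (Fin.init (Fin.init v)))) (v (Fin.last (m + 1)).castSucc)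
          (v (Fin.last (m + 2)) + 1) =
        F (Fin.snoc (Fin.snoc (Fin.init (Fin.init (Fin.init v))) (v (Fin.last (m + 2))))
          (seqEl (itBound r sN (Fin.init (Fin.init (Fin.init v))))
            (itWidth r (Fin.init (Fin.init (Fin.init v)))) (v (Fin.last (m + 1)).castSucc)
            (v (Fin.last (m + 2)))))) ?_ hbd2 |>.of_iff fun u => ?_
    · refine IsSigmabDef.imp ((isQFDef_lt (IsTermFn.proj _) (IsTermFn.proj _)).isPibDef _) ?_
      have ha : IsSigmabFn (i + 1) fun v : Fin (m + 3) → M =>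
          seqEl (itBound r sN (Fin.init (Fin.init (Fin.init v))))
            (itWidth r (Fin.init (Fin.init (Fin.init v)))) (v (Fin.last (m + 1)).castSucc)
            (v (Fin.last (m + 2)) + 1) :=
        (hEl.substAll (isTermFn_vec4 hbd3 hw3 (IsTermFn.proj (Fin.last (m + 1)).castSucc)
          (isTermFn_add_one (IsTermFn.proj (Fin.last (m + 2)))))).of_eq fun v => rfl
      have hc : IsSigmabFn (i + 1) fun v : Fin (m + 3) → M =>
          seqEl (itBound r sN (Fin.init (Fin.init (Fin.init v))))
            (itWidth r (Fin.init (Fin.init (Fin.init v)))) (v (Fin.last (m + 1)).castSucc)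
            (v (Fin.last (m + 2))) :=
        (hEl.substAll (isTermFn_vec4 hbd3 hw3 (IsTermFn.proj (Fin.last (m + 1)).castSucc)
          (IsTermFn.proj (Fin.last (m + 2))))).of_eq fun v => rfl
      -- `F (x̄, j, c)` as a function of `(x̄, l, H, j, c)`
      let e : Fin (m + 2) → Fin (m + 4) :=
        Fin.snoc (α := fun _ => Fin (m + 4))
          (Fin.snoc (α := fun _ => Fin (m + 4)) (fun k => k.castSucc.castSucc.castSucc.castSucc)
            (Fin.last (m + 2)).castSucc) (Fin.last (m + 3))
      have hFe : IsSigmabFn (i + 1) fun v' : Fin (m + 4) → M => F (v' ∘ e) := hF.comp e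
      have hFc : IsSigmabFn (i + 1) fun v : Fin (m + 3) → M =>
          F (Fin.snoc (Fin.snoc (Fin.init (Fin.init (Fin.init v))) (v (Fin.last (m + 2))))
            (seqEl (itBound r sN (Fin.init (Fin.init (Fin.init v))))
              (itWidth r (Fin.init (Fin.init (Fin.init v)))) (v (Fin.last (m + 1)).castSucc)
              (v (Fin.last (m + 2))))) := by
        refine (hFe.snocFn hc ⟨fun v => r (Fin.init (Fin.init (Fin.init v))), hxs3 hr,
          fun v => ?_⟩).of_eq fun v => ?_
        · simpa using hFr (Fin.snoc v _ ∘ e) |>.trans_eq (by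
            congr 1
            funext k
            simp [e, Fin.init])
        · congr 1
          funext k
          cases k using Fin.lastCases with
          | last => simp [e]
          | cast k =>
            cases k using Fin.lastCases with
            | last => simp [e]
            | cast k => simp [e, Fin.init]
      exact (ha.isDeltabDef_eq hFc).1
    · simp only [Fin.init_snoc, Fin.snoc_castSucc, Fin.snoc_last, mLe_iff]

/-! ### Existence of computations and the iterate -/

/-- **Existence of computations** of every length `l + 1`, `l ≤ |s x̄|`, by `Σᵇᵢ₊₁`-induction on
`l` (Buss 1986, §2.6). [cite: Buss1986, §2.6] -/
theorem exists_isItSeq (hIi : M ⊨ INDScheme (sigmabFormulas (i + 1)))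
    (hF : IsSigmabFn (i + 1) F) (hinitF : IsSigmabFn (i + 1) init) (hr : IsTermFn r) (hsN : IsTermFn sN)
    (xs : Fin m → M) {l : M} (hl : l ≤ mLen (sN xs)) : ∃ H, IsItSeq F init r sN xs l H := by
  set S := itBound r sN xs
  set b := itWidth r xs
  have hmain : IsSigmabDef (i + 1) fun w : Fin 2 → M => IsItSeq F init r sN xs (w 0) (w 1) :=
    ((isSigmabDef_isItSeq hF hinitF hr hsN hFr).substAll (T := Fin.snoc (α := fun _ =>
      (Fin 2 → M) → M) (Fin.snoc (α := fun _ => (Fin 2 → M) → M) (fun j _ => xs j)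
        fun w => w 0) fun w => w 1) fun j => by
          cases j using Fin.lastCases with
          | last => simpa using IsTermFn.proj (1 : Fin 2)
          | cast j =>
            cases j using Fin.lastCases with
            | last => simpa using IsTermFn.proj (0 : Fin 2)
            | cast j => simpa using IsTermFn.const (xs j)).of_iff fun w => by
      have e : (Fin.init (Fin.init fun j => Fin.snoc (α := fun _ => (Fin 2 → M) → M)
          (Fin.snoc (α := fun _ => (Fin 2 → M) → M) (fun j _ => xs j) fun w => w 0)
          (fun w => w 1) j w)) = xs := by
        funext k
        simp [Fin.init]
      simp [e]
  suffices aux : ∀ l, l ≤ mLen (sN xs) →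
      ∃ H, H ≤ pow2B S ((mLen (sN xs) + 1) * b) ∧ IsItSeq F init r sN xs l H by
    obtain ⟨H, -, hH⟩ := aux l hl
    exact ⟨H, hH⟩
  intro l
  refine ind_level hIi (P := fun l => l ≤ mLen (sN xs) →
    ∃ H, H ≤ pow2B S ((mLen (sN xs) + 1) * b) ∧ IsItSeq F init r sN xs l H) ?_ ?_ ?_ l
  · refine IsSigmabDef.imp ((isQFDef_le (IsTermFn.proj 0) (IsTermFn.const _)).isPibDef _) ?_
    exact (hmain.bexLE (IsTermFn.const (pow2B S ((mLen (sN xs) + 1) * b)))).of_iff fun v => by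
      simp
  · intro _
    refine ⟨init xs, ?_, isItSeq_zero hinit xs⟩
    refine (lt_pow2B_itWidth (sN := sN) (hinit xs)).le.trans (pow2B_mono _ ?_)
    conv_lhs => rw [← one_mul (itWidth r xs)]
    exact mul_le_mul'' (le_add_left'' 1 _) le_rfl
  · intro l ih hl1
    obtain ⟨H, -, hH⟩ := ih ((le_add_right'' l 1).trans hl1)
    refine ⟨_, ?_, hH.append hFr hl1⟩
    refine (hH.append hFr hl1).1.le.trans (pow2B_mono _ (mul_le_mul'' ?_ le_rfl))
    simpa using hl1

omit hFr hinit in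
/-- The iterate is read off any computation (`l ≤ |s x̄|`). [cite: Buss1986, §2.6] -/
theorem iter_eq_seqEl {xs : Fin m → M} {l H : M} (hl : l ≤ mLen (sN xs))
    (hH : IsItSeq F init r sN xs l H) :
    iter F init r sN xs l = seqEl (itBound r sN xs) (itWidth r xs) H l := by
  have hex : ∃ H, IsItSeq F init r sN xs l H := ⟨H, hH⟩
  rw [iter, dif_pos ⟨hl, hex⟩]
  exact (Classical.choose_spec hex).seqEl_eq hH hl le_rfl

omit hFr in
/-- **Recursion equation, base**: `iter x̄ 0 = init x̄`. [cite: Buss1986, §2.6] -/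
theorem iter_zero (xs : Fin m → M) : iter F init r sN xs 0 = init xs := by
  rw [iter_eq_seqEl (l := 0) bot_le (isItSeq_zero hinit xs)]
  exact (isItSeq_zero (F := F) (sN := sN) hinit xs).2.1

/-- **Recursion equation, step**: `iter x̄ (l + 1) = F(x̄, l, iter x̄ l)` for `l + 1 ≤ |s x̄|`.
[cite: Buss1986, §2.6] -/
theorem iter_succ (hIi : M ⊨ INDScheme (sigmabFormulas (i + 1)))
    (hF : IsSigmabFn (i + 1) F) (hinitF : IsSigmabFn (i + 1) init) (hr : IsTermFn r) (hsN : IsTermFn sN)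
    {xs : Fin m → M} {l : M} (hl : l + 1 ≤ mLen (sN xs)) :
    iter F init r sN xs (l + 1) = F (Fin.snoc (Fin.snoc xs l) (iter F init r sN xs l)) := by
  obtain ⟨H, hH⟩ := exists_isItSeq hFr hinit hIi hF hinitF hr hsN xs ((le_add_right'' l 1).trans hl)
  rw [iter_eq_seqEl hl (hH.append hFr hl),
    iter_eq_seqEl ((le_add_right'' l 1).trans hl) hH,
    seqEl_add_mul_pow2B_self hH.1 (lt_pow2B_itWidth (step_le hFr xs l _))]

omit hFr hinit in
/-- `iter x̄ l = 0` for `l > |s x̄|`. [folklore] -/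
theorem iter_of_lt {xs : Fin m → M} {l : M} (hl : mLen (sN xs) < l) : iter F init r sN xs l = 0 := by
  rw [iter, dif_neg]
  exact fun h => hl.not_ge h.1

/-- **The iterate is bounded by `r`**. [cite: Buss1986, §2.6] -/
theorem iter_le (hIi : M ⊨ INDScheme (sigmabFormulas (i + 1)))
    (hF : IsSigmabFn (i + 1) F) (hinitF : IsSigmabFn (i + 1) init) (hr : IsTermFn r) (hsN : IsTermFn sN)
    (xs : Fin m → M) (l : M) : iter F init r sN xs l ≤ r xs := by
  rcases le_or_gt l (mLen (sN xs)) with hl | hl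
  · rcases eq_or_ne l 0 with rfl | hl0
    · rw [iter_zero hinit]
      exact hinit xs
    · obtain ⟨l, rfl⟩ := exists_eq_add_one_of_ne_zero hl0
      rw [iter_succ hFr hinit hIi hF hinitF hr hsN hl]
      exact step_le hFr xs _ _
  · rw [iter_of_lt hl]
    exact bot_le

/-! ### The iterate is `Σᵇᵢ₊₁`-definable -/

/-- **The iterate is a `Σᵇᵢ₊₁`-definable function** of `(x̄, l)`:
`y = iter x̄ l ↔ (l ≤ |s x̄| ∧ ∃ H ≤ 2·S + 1 (IsItSeq x̄ l H ∧ y = digit_l H)) ∨ (|s x̄| < l ∧ y = 0)`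
(Buss 1986, §2.6; Buss 1990, Thm. 11). [cite: Buss1986, §2.6] -/
theorem isSigmabFn_iter (hIi : M ⊨ INDScheme (sigmabFormulas (i + 1)))
    (hF : IsSigmabFn (i + 1) F) (hinitF : IsSigmabFn (i + 1) init) (hr : IsTermFn r) (hsN : IsTermFn sN) :
    IsSigmabFn (i + 1) fun u : Fin (m + 1) → M => iter F init r sN (Fin.init u) (u (Fin.last m)) := by
  -- term functions on `(x̄, l, y)` and `(x̄, l, y, H)`
  have hx3 : ∀ {T : (Fin m → M) → M}, IsTermFn T →
      IsTermFn fun v : Fin (m + 3) → M => T (Fin.init (Fin.init (Fin.init v))) := fun hT =>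
    (((hT.comp Fin.castSucc).comp Fin.castSucc).comp Fin.castSucc).of_eq fun _ => rfl
  have hbd3 : IsTermFn fun v : Fin (m + 3) → M => itBound r sN (Fin.init (Fin.init (Fin.init v))) :=
    ((isTermFn_add_one (isTermFn_two_mul (hx3 hsN))).smash
      (isTermFn_add_one (isTermFn_two_mul (hx3 hr)))).of_eq fun _ => rfl
  have hw3 : IsTermFn fun v : Fin (m + 3) → M => itWidth r (Fin.init (Fin.init (Fin.init v))) :=
    (hx3 hr).len
  -- `IsItSeq x̄ l H` on the context `(x̄, l, y, H)`
  let e : Fin (m + 2) → Fin (m + 3) :=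
    Fin.snoc (α := fun _ => Fin (m + 3)) (Fin.snoc (α := fun _ => Fin (m + 3))
      (fun j : Fin m => j.castSucc.castSucc.castSucc) (Fin.last m).castSucc.castSucc) (Fin.last (m + 2))
  have hSeq : IsSigmabDef (i + 1) fun v : Fin (m + 3) → M =>
      IsItSeq F init r sN (Fin.init (Fin.init (Fin.init v))) (v (Fin.last m).castSucc.castSucc)
        (v (Fin.last (m + 2))) := by
    refine ((isSigmabDef_isItSeq hF hinitF hr hsN hFr).comp e).of_iff fun v => ?_
    have e1 : (v ∘ e) (Fin.last m).castSucc = v (Fin.last m).castSucc.castSucc := by simp [e]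
    have e2 : (v ∘ e) (Fin.last (m + 1)) = v (Fin.last (m + 2)) := by simp [e]
    have e3 : Fin.init (Fin.init (v ∘ e)) = Fin.init (Fin.init (Fin.init v)) := by
      funext j
      simp [e, Fin.init]
    rw [e1, e2, e3]
  -- `y = digit_l H`
  have hEq : IsSigmabDef (i + 1) fun v : Fin (m + 3) → M =>
      v (Fin.last (m + 1)).castSucc = seqEl (itBound r sN (Fin.init (Fin.init (Fin.init v))))
        (itWidth r (Fin.init (Fin.init (Fin.init v)))) (v (Fin.last (m + 2)))
        (v (Fin.last m).castSucc.castSucc) :=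
    ((isSigmabFn_of_isTermFn (IsTermFn.proj _) _).isDeltabDef_eq
      (((isSigmabFn_seqEl.mono (Nat.le_add_left 1 i)).substAll (isTermFn_vec4 hbd3 hw3
        (IsTermFn.proj (Fin.last (m + 2))) (IsTermFn.proj (Fin.last m).castSucc.castSucc))).of_eq
        fun v => rfl)).1
  -- the graph
  have hsN2 : IsTermFn fun u : Fin (m + 2) → M => mLen (sN (Fin.init (Fin.init u))) :=
    (((hsN.comp Fin.castSucc).comp Fin.castSucc).of_eq fun _ => rfl).len
  have hG : IsSigmabDef (i + 1) fun u : Fin (m + 2) → M =>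
      (u (Fin.last m).castSucc ≤ mLen (sN (Fin.init (Fin.init u))) ∧
        ∃ H, H ≤ 2 * itBound r sN (Fin.init (Fin.init u)) + 1 ∧
          (IsItSeq F init r sN (Fin.init (Fin.init u)) (u (Fin.last m).castSucc) H ∧
            u (Fin.last (m + 1)) = seqEl (itBound r sN (Fin.init (Fin.init u)))
              (itWidth r (Fin.init (Fin.init u))) H (u (Fin.last m).castSucc))) ∨
      (mLen (sN (Fin.init (Fin.init u))) < u (Fin.last m).castSucc ∧ u (Fin.last (m + 1)) = 0) := by
    have hx2 : ∀ {T : (Fin m → M) → M}, IsTermFn T →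
        IsTermFn fun u : Fin (m + 2) → M => T (Fin.init (Fin.init u)) := fun hT =>
      ((hT.comp Fin.castSucc).comp Fin.castSucc).of_eq fun _ => rfl
    have hbd2 : IsTermFn fun u : Fin (m + 2) → M => itBound r sN (Fin.init (Fin.init u)) :=
      ((isTermFn_add_one (isTermFn_two_mul (hx2 hsN))).smash
        (isTermFn_add_one (isTermFn_two_mul (hx2 hr)))).of_eq fun _ => rfl
    refine (((isQFDef_le (IsTermFn.proj (Fin.last m).castSucc) hsN2).isSigmabDef _).and
      ((hSeq.and hEq).bexLE (isTermFn_add_one (isTermFn_two_mul hbd2)))).or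
      (((isQFDef_lt hsN2 (IsTermFn.proj (Fin.last m).castSucc)).and
        (isQFDef_eq (IsTermFn.proj (Fin.last (m + 1))) isTermFn_zero)).isSigmabDef _)
      |>.of_iff fun u => ?_
    simp only [Fin.snoc_last, Fin.init_snoc, Fin.snoc_castSucc, mLe_iff]
  refine ⟨hG.of_iff fun u => ?_, fun u => r (Fin.init u), (hr.comp Fin.castSucc).of_eq (fun _ => rfl),
    fun u => iter_le hFr hinit hIi hF hinitF hr hsN _ _⟩
  -- `graphPred` versus the disjunction
  simp only [graphPred]
  set xs := Fin.init (Fin.init u) with hxs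
  set l := u (Fin.last m).castSucc with hl
  set y := u (Fin.last (m + 1)) with hy
  have exs : Fin.init u = Fin.snoc xs l := by
    rw [hxs, hl]
    conv_lhs => rw [← Fin.snoc_init_self (Fin.init u)]
    rfl
  rw [exs, Fin.snoc_last]
  constructor
  · rintro (⟨hle, H, -, hH, hyH⟩ | ⟨hlt, hy0⟩)
    · rw [hyH]
      exact (iter_eq_seqEl hle hH).symm
    · rw [hy0]
      exact (iter_of_lt hlt).symm
  · intro hyl
    rcases le_or_gt l (mLen (sN xs)) with hle | hlt
    · obtain ⟨H, hH⟩ := exists_isItSeq hFr hinit hIi hF hinitF hr hsN xs hle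
      refine Or.inl ⟨hle, H, ?_, hH, ?_⟩
      · exact hH.1.le.trans (pow2B_le _ _)
      · rw [hyl, iter_eq_seqEl hle hH]
    · exact Or.inr ⟨hlt, by rw [hyl, iter_of_lt hlt]⟩

end Iterate

end BASICModel

end Literature.Computability.MetaComplexity
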